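import Summits.RiemannHypothesis.RiemannHypothesis.Theorems.HandoffSemilocalOddBump
import Summits.RiemannHypothesis.RiemannHypothesis.Theorems.HandoffFlatLobe
import HarnessLib

/-!
# HANDOFF — the wall ceiling and the deficit slope with SHARP constants: `(1+ε)·(log N)/(2√N)` and `(1−ε)·√N·δ` (rh-explicit, track «HANDOFF», seat prove-2 gen5, ATTEMPT-12 part 4)

HONEST FRAMING. Nothing here bears on the truth of RH. Parts 2–3 (`HandoffWallCeiling.lean`, `HandoffDeficitSlope.lean`) prove, RH-free, for every
finite `S ⊆ [0, N)`: `a*(S) < (log N)/2 + (cramerGapConst/4)(log N)/√N` and `D_N((log N)/2 + δ) ≥ √N·δ/(2e‖φ₀‖₂²) − O(log(1/δ))`, with gen2's Cramér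
bump `φ₀` (Mathlib's unspecified bump; the constants `cramerGapConst ≥ 1`, `‖φ₀‖₂² ≥ 1/2` are symbolic). Replacing the bump by gen3's FLAT LOBES `ψ_k`
(`HandoffFlatProfile/FlatLobe.lean`: mass `M_k ∈ [2 − 2/(k+2), 2]`, `N_k = ‖ψ_k‖₂² ≤ 2`, energy ceiling `log(1/r) + flatEnergyConst k`) pins the
LEADING constants, exactly as gen3's `HandoffEdgeSharp.lean` did for the Cramér gap:

* §1 the odd flat two-bump in every `Q_S`, `S ⊆ [0, N)`: `Re Q_S(f − f(−·)) ≤ 2rN_k(log(1/r) + flatEnergyConst k + 6.1) − 2√N·r²·M_k²`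
  (`re_weilSemilocalQuadratic_oddFlatBump_le`; here `e^{x₀ − r} = √N` exactly);
* §2 **DEFICIT SLOPE, sharp** (RH-free): `λ_min(S; (log N)/2 + δ) ≤ log(2/δ) + flatEnergyConst k + 6.1 − (1 − 1/(k+2))²·√N·δ` for every `k`,
  `N ≥ 10⁷`, `0 < δ ≤ 1/4` (`semilocalGroundEnergy_le_slope_sharp`, `aggregateDeficit_ge_slope_sharp`): slope `(1 − ε)√N` — HALF of the missing weight
  `Σ_{N ≤ p ≤ N e^{2δ}} log p/√p ≈ 2√N·δ` that bounds the deficit from above under RH (part 3, `aggregateDeficit_le_missingWeight_of_riemannHypothesis`);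
* §3 **WALL CEILING, sharp** (RH-free): for `0 < ε ≤ 1`, `k` with `ε(k+2) ≥ 8`, `N ≥ 10⁷` with `4(flatEnergyConst k + 5) ≤ ε·log N`:
  `a*(S) < (log N)/2 + (1+ε)·(log N)/(2√N)` (`weilSemilocalThreshold_lt_ceiling_sharp`, `wall_lt_ceiling_sharp`), and for EVERY `ε > 0`:
  `∃ N₀, ∀ N ≥ N₀, W(N) < (log N)/2 + (1+ε)(log N)/(2√N)` (`exists_forall_wall_lt_ceiling_sharp`). The constant `1` matches gen3's two-sided
  classification of the odd edge block (`edgeNonnegOdd_sharp_classification`: necessary with `1+ε`, sufficient with `1−ε`): it is the exact reach of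
  edge-localised odd witnesses, NOT the true size of the wall offsets (`δ*(q) ≈ 0.106/(w_q q(q−1))`, cell DATA).

`flatEnergyConst k = 6.125 + L_k/(2π)` carries the log-moment `L_k` of Mathlib's unspecified smooth transition, so the threshold `N₀(ε)` is symbolic
(same caveat as `HandoffEdgeSharp`); the leading constants `1 + ε` and `(1 − 1/(k+2))²` are numbers.

References: E. Bombieri, Rend. Mat. Acc. Lincei (9) 11 (2000), Thm 2 / §4 Problem 2 (`Bombieri2000Weil`); H. Cramér, Ark. Mat. Astr. Fys. 15 (1920) no. 5;
E. Carneiro, M. Milinovich, K. Soundararajan, Comment. Math. Helv. 94 (2019) Thm 5 (`CarneiroMilinovichSoundararajan2019`, the constant 22/25 under RH);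
A. Connes, C. Consani, Enseign. Math. 69 (2023) 93–148 = arXiv:2106.01715, §2.2–2.4 (`ConnesConsani2023`, the semi-local bottom with and without a prime).
-/

set_option linter.dupNamespace false

noncomputable section

open Complex Filter Set MeasureTheory Literature.NumberTheory.LFunctions
open Summit.RiemannHypothesis.RiemannHypothesis.Theorems.MotivicDoor.SemilocalThreshold
open Summit.RiemannHypothesis.RiemannHypothesis.Theorems.HandoffSemilocalEnergy (semilocalGroundEnergy aggregateDeficit
  semilocalGroundEnergy_mul_le_re semilocalGroundEnergy_top_nonneg_iff_le_threshold)
open scoped Real Topology ComplexConjugate ContDiff ArithmeticFunction.vonMangoldt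

namespace Summit.RiemannHypothesis.RiemannHypothesis.Theorems.Handoff

variable {S : Finset ℕ} {N k : ℕ} {r : ℝ}

/-! ## §1 The odd flat two-bump in `Q_S` -/

/-- **Energy ceiling of a flat lobe in every `Q_S`** (`0 < r ≤ 1/4`): `Re Q_S(flatLobe k r x₀) ≤ (log(1/r) + flatEnergyConst k)·∫‖flatLobe k r x₀‖²`
— the lobe is too narrow to see a prime (`weilSemilocalQuadratic_eq_weilQuadratic_of_narrow` + gen3's `re_weilQuadratic_flatLobe_le`).
[this track, ATTEMPT-9 §2 / ATTEMPT-12 part 4] -/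
theorem re_weilSemilocalQuadratic_flatLobe_le (S : Finset ℕ) (hr : 0 < r) (hr4 : r ≤ 1 / 4) (x₀ : ℝ) :
    (weilSemilocalQuadratic S (flatLobe k r x₀)).re ≤
      (Real.log (1 / r) + flatEnergyConst k) * ∫ x : ℝ, ‖flatLobe k r x₀ x‖ ^ 2 := by
  have hl2 := Real.log_two_gt_d9
  have hsupp : tsupport (flatLobe k r x₀) ⊆ Icc (x₀ - Real.log 2 / 2) (x₀ + Real.log 2 / 2) :=
    (tsupport_flatLobe_subset hr x₀).trans (Icc_subset_Icc (by linarith) (by linarith))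
  rw [weilSemilocalQuadratic_eq_weilQuadratic_of_narrow S (isWeilTest_flatLobe hr x₀) hsupp]
  exact re_weilQuadratic_flatLobe_le hr hr4 x₀

/-- **The odd flat two-bump in every truncated form.** For `S ⊆ [0, N)`, `N ≥ 10⁷`, `0 < r ≤ 1/8`, with `x₀ = (log N)/2 + r`, `f = flatLobe k r x₀`,
`N_k = ‖ψ_k‖₂²`, `M_k = ∫ψ_k`: `Re Q_S(f − f(−·)) ≤ 2rN_k·(log(1/r) + flatEnergyConst k + 6.1) − 2√N·r²·M_k²`. [this track, ATTEMPT-12 part 4] -/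
theorem re_weilSemilocalQuadratic_oddFlatBump_le (k : ℕ) (hS : ∀ p ∈ S, p < N) (hN7 : (10 : ℝ) ^ 7 ≤ N) (hr : 0 < r)
    (hr8 : r ≤ 1 / 8) :
    (weilSemilocalQuadratic S (fun x ↦ flatLobe k r (Real.log N / 2 + r) x - flatLobe k r (Real.log N / 2 + r) (-x))).re ≤
      2 * (r * weilNorm2Sq (flatProfile k)) * (Real.log (1 / r) + flatEnergyConst k + 6.1) -
        2 * (Real.sqrt N * r ^ 2 * flatMass k ^ 2) := by
  have hN0 : (0 : ℝ) < N := lt_of_lt_of_le (by norm_num) hN7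
  have h16 : Real.exp 16 ≤ N := exp_sixteen_le.trans hN7
  have hlog16 : (16 : ℝ) ≤ Real.log N := by
    rw [Real.le_log_iff_exp_le hN0]; exact h16
  have hr4 : r ≤ 1 / 4 := by linarith only [hr8]
  set c' : ℝ := Real.log N / 2 with hc'_def
  have hc'8 : 8 ≤ c' := by rw [hc'_def]; linarith only [hlog16]
  have hc'pos : 0 < c' := by linarith only [hc'8]
  set x₀ : ℝ := c' + r with hx₀_def
  set b : ℝ := c' + 2 * r with hb_def
  have hcb : c' ≤ b := by rw [hb_def]; linarith only [hr]
  have hexp2b : Real.exp (2 * b) = N * Real.exp (4 * r) := by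
    rw [hb_def, show 2 * (c' + 2 * r) = Real.log N + 4 * r by rw [hc'_def]; ring, Real.exp_add, Real.exp_log hN0]
  have hNb : (N : ℝ) ≤ Real.exp (2 * b) := by
    rw [hexp2b]
    have h1 : 1 ≤ Real.exp (4 * r) := Real.one_le_exp (by positivity)
    nlinarith only [h1, hN0]
  have h2N : Real.exp (2 * b) ≤ 2 * N := by
    rw [hexp2b]
    have he : Real.exp (4 * r) ≤ Real.exp (1 / 2) := Real.exp_le_exp.2 (by linarith only [hr8])
    have hsq : Real.exp (1 / 2) * Real.exp (1 / 2) = Real.exp 1 := by rw [← Real.exp_add]; norm_num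
    have he2 : Real.exp (1 / 2) ≤ 2 := by nlinarith [Real.exp_pos (1 / 2), Real.exp_one_lt_d9]
    nlinarith only [he.trans he2, hN0]
  set f := flatLobe k r x₀ with hf_def
  have hf : IsWeilTest f := isWeilTest_flatLobe hr x₀
  have hfs : tsupport f ⊆ Icc c' b := by
    refine (tsupport_flatLobe_subset hr x₀).trans (Icc_subset_Icc ?_ ?_)
    · rw [hx₀_def]; linarith only
    · rw [hx₀_def, hb_def]; linarith only
  have hE := re_weilSemilocalQuadratic_flatLobe_le (k := k) S hr hr4 x₀
  have hP := normSq_weilMellin_flatLobe_one_ge (k := k) hr x₀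
  have hexp : Real.exp (x₀ - r) = Real.sqrt N := by
    rw [hx₀_def, show c' + r - r = c' by ring, hc'_def, show Real.log N / 2 = Real.log N * (1 / 2) by ring, Real.exp_mul,
      Real.exp_log hN0, Real.sqrt_eq_rpow]
  rw [hexp] at hP
  have hNf : ∫ x : ℝ, ‖f x‖ ^ 2 = r * weilNorm2Sq (flatProfile k) := integral_norm_sq_flatLobe hr x₀
  set Φ := weilNorm2Sq (flatProfile k) with hΦ
  have hΦ1 : 1 ≤ Φ := one_le_weilNorm2Sq_flatProfile k
  have hrΦ : 0 ≤ r * Φ := by positivity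
  set G := ∑ n ∈ Finset.Icc ⌈Real.exp (2 * c')⌉₊ ⌊Real.exp (2 * b)⌋₊, weilSemilocalCoeff S n with hG_def
  have hB : G ≤ 3 := sum_weilSemilocalCoeff_le_three hS hN7 hNb h2N
  have hM : archGapBound c' ≤ 0.002 := by
    unfold archGapBound
    have he : (1000 : ℝ) ≤ Real.exp c' := exp_seven_ge.trans (Real.exp_le_exp.2 (by linarith only [hc'8]))
    have hx : Real.exp (-(4 * c')) ≤ 1 / 2 := by
      have h1 : Real.exp (-(4 * c')) ≤ Real.exp (-1) := Real.exp_le_exp.2 (by linarith only [hc'8])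
      have h2 := Real.exp_neg_one_lt_d9
      linarith only [h1, h2]
    have hden : (500 : ℝ) ≤ Real.exp c' * (1 - Real.exp (-(4 * c'))) := by
      nlinarith only [he, hx, Real.exp_pos c']
    rw [div_le_iff₀ (by linarith only [hden])]
    linarith only [hden]
  have hX : 4 * archGapBound c' * (b - c') + 2 * G ≤ 6.1 := by
    have hM0 : 0 ≤ archGapBound c' := (archGapBound_pos hc'pos).le
    have hbc : b - c' ≤ 1 := by rw [hb_def]; linarith only [hr8]
    have hbc0 : 0 ≤ b - c' := by linarith only [hcb]
    have hprod : archGapBound c' * (b - c') ≤ 0.002 * 1 := mul_le_mul hM hbc hbc0 (by norm_num)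
    linarith only [hprod, hB]
  have hU := re_weilSemilocalQuadratic_sub_comp_neg_le S hf hc'pos hcb hfs
  have h0 : 0 ≤ Complex.normSq (weilMellin f 0) := Complex.normSq_nonneg _
  rw [hNf] at hE hU
  have hX' : 2 * (4 * archGapBound c' * (b - c') + 2 * G) * (r * Φ) ≤ 2 * 6.1 * (r * Φ) := by nlinarith only [hX, hrΦ]
  nlinarith only [hU, hE, hX', hP, h0, hrΦ]

/-! ## §2 The deficit slope with constant `(1 − 1/(k+2))²` -/

/-- **DEFICIT SLOPE, sharp (RH-free).** For every finite `S ⊆ [0, N)`, `N ≥ 10⁷`, every order `k` and every `0 < δ ≤ 1/4`: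
`λ_min(S; (log N)/2 + δ) ≤ log(2/δ) + flatEnergyConst k + 6.1 − (1 − 1/(k+2))²·√N·δ`. [this track, ATTEMPT-12 part 4; cite: Bombieri2000Weil, §4 Problem 2 (the window infimum)] -/
theorem semilocalGroundEnergy_le_slope_sharp (k : ℕ) (hS : ∀ p ∈ S, p < N) (hN7 : (10 : ℝ) ^ 7 ≤ N) {δ : ℝ} (hδ : 0 < δ)
    (hδ4 : δ ≤ 1 / 4) :
    semilocalGroundEnergy S (fun _ ↦ True) (Real.log N / 2 + δ) ≤
      Real.log (2 / δ) + flatEnergyConst k + 6.1 - (1 - 1 / ((k : ℝ) + 2)) ^ 2 * Real.sqrt N * δ := by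
  have hN0 : (0 : ℝ) < N := lt_of_lt_of_le (by norm_num) hN7
  have hlog16 : (16 : ℝ) ≤ Real.log N := by
    rw [Real.le_log_iff_exp_le hN0]; exact exp_sixteen_le.trans hN7
  have hsq : 0 < Real.sqrt N := Real.sqrt_pos.2 hN0
  set r : ℝ := δ / 2 with hr_def
  have hr : 0 < r := by positivity
  have hr8 : r ≤ 1 / 8 := by rw [hr_def]; linarith only [hδ4]
  set c' : ℝ := Real.log N / 2 with hc'_def
  have hc'pos : 0 < c' := by rw [hc'_def]; linarith only [hlog16]
  set x₀ : ℝ := c' + r with hx₀_def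
  have hwin : Real.log N / 2 + δ = c' + 2 * r := by rw [hc'_def, hr_def]; ring
  have hW := re_weilSemilocalQuadratic_oddFlatBump_le k hS hN7 hr hr8
  have hx₀eq : Real.log N / 2 + r = x₀ := by rw [hx₀_def, hc'_def]
  rw [hx₀eq] at hW
  set f := flatLobe k r x₀ with hf_def
  have hf : IsWeilTest f := isWeilTest_flatLobe hr x₀
  have hfs : tsupport f ⊆ Icc c' (c' + 2 * r) := by
    refine (tsupport_flatLobe_subset hr x₀).trans (Icc_subset_Icc ?_ ?_)
    · rw [hx₀_def]; linarith only
    · rw [hx₀_def]; linarith only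
  set F : ℝ → ℂ := fun x ↦ f x - f (-x) with hF_def
  have hF : IsWeilTest F := isWeilTest_sub_comp_neg hf
  have hFs : tsupport F ⊆ Icc (-(c' + 2 * r)) (c' + 2 * r) :=
    tsupport_sub_comp_neg_subset hc'pos.le (by linarith only [hr]) hfs
  set Φ := weilNorm2Sq (flatProfile k) with hΦ
  have hΦ1 : 1 ≤ Φ := one_le_weilNorm2Sq_flatProfile k
  have hΦ2 : Φ ≤ 2 := weilNorm2Sq_flatProfile_le_two k
  have hΦpos : 0 < Φ := by linarith only [hΦ1]
  -- Rayleigh and the exact mass of the two-bump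
  have hRay := semilocalGroundEnergy_mul_le_re (S := S) (P := fun _ ↦ True) hF hFs (fun _ _ ↦ trivial)
  have hI : ∫ x : ℝ, ‖F x‖ ^ 2 = 2 * (r * Φ) := by
    have hzero : ∀ y : ℝ, y ∉ Icc c' (c' + 2 * r) → f y = 0 :=
      fun y hy ↦ image_eq_zero_of_notMem_tsupport fun h ↦ hy (hfs h)
    have hpt : ∀ x : ℝ, ‖F x‖ ^ 2 = ‖f x‖ ^ 2 + ‖f (-x)‖ ^ 2 := by
      intro x
      rcases le_or_gt 0 x with hx | hx
      · rw [hF_def]; dsimp only; rw [hzero (-x) (fun hm ↦ by linarith [hm.1])]; simp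
      · rw [hF_def]; dsimp only; rw [hzero x (fun hm ↦ by linarith [hm.1])]; simp
    simp_rw [hpt]
    rw [integral_add hf.integrable_norm_sq (hf.integrable_norm_sq.comp_neg),
      integral_neg_eq_self (fun u : ℝ ↦ ‖f u‖ ^ 2) volume, integral_norm_sq_flatLobe hr x₀]
    ring
  rw [hI] at hRay
  -- mass ratio: `M_k² ≥ (2ρ)²`, `N_k ≤ 2`
  set ρ : ℝ := 1 - 1 / ((k : ℝ) + 2) with hρ_def
  have hρM : 2 * ρ ≤ flatMass k := by rw [hρ_def, ← flatBump_rIn]; exact two_mul_rIn_le_flatMass k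
  have hρ0 : 0 ≤ 2 * ρ := by
    have := half_le_flatBump_rIn k
    rw [flatBump_rIn] at this
    rw [hρ_def]; linarith only [this]
  have hM2 : (2 * ρ) ^ 2 ≤ flatMass k ^ 2 := pow_le_pow_left₀ hρ0 hρM 2
  set L := semilocalGroundEnergy S (fun _ ↦ True) (c' + 2 * r) with hL_def
  set A := Real.log (1 / r) + flatEnergyConst k + 6.1 with hA_def
  -- `L·(2rΦ) ≤ 2rΦ·A − 2√N r² M_k² ≤ 2rΦ·A − 2√N r²(2ρ)²` and `Φ ≤ 2`
  have hmain : L * (2 * (r * Φ)) ≤ 2 * (r * Φ) * A - 2 * (Real.sqrt N * r ^ 2 * (2 * ρ) ^ 2) := by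
    have h3 := hRay.trans hW
    have h4 : Real.sqrt N * r ^ 2 * (2 * ρ) ^ 2 ≤ Real.sqrt N * r ^ 2 * flatMass k ^ 2 :=
      mul_le_mul_of_nonneg_left hM2 (by positivity)
    linarith only [h3, h4]
  have hrΦ : 0 < 2 * (r * Φ) := by positivity
  have hdiv : L ≤ A - Real.sqrt N * r * (2 * ρ) ^ 2 / Φ := by
    by_contra hcon
    rw [not_le] at hcon
    have hm := mul_lt_mul_of_pos_right hcon hrΦ
    have e : (A - Real.sqrt N * r * (2 * ρ) ^ 2 / Φ) * (2 * (r * Φ)) =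
        2 * (r * Φ) * A - 2 * (Real.sqrt N * r ^ 2 * (2 * ρ) ^ 2) := by
      field_simp
    linarith only [hm, hmain, e]
  -- `√N r (2ρ)²/Φ ≥ √N r (2ρ)²/2 = ρ²·√N·δ`
  have hfrac : ρ ^ 2 * Real.sqrt N * δ ≤ Real.sqrt N * r * (2 * ρ) ^ 2 / Φ := by
    rw [le_div_iff₀ hΦpos, hr_def]
    have h1 : 0 ≤ ρ ^ 2 * Real.sqrt N * δ := by positivity
    nlinarith only [hΦ2, h1]
  have hlr : Real.log (1 / r) = Real.log (2 / δ) := by rw [hr_def, one_div_div]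
  rw [hwin, ← hlr]
  rw [hA_def] at hdiv
  linarith only [hdiv, hfrac]

/-- **DEFICIT SLOPE, sharp, handoff form (RH-free)**: `D_N((log N)/2 + δ) ≥ (1 − 1/(k+2))²·√N·δ − log(2/δ) − flatEnergyConst k − 6.1`
(`N ≥ 10⁷`, `0 < δ ≤ 1/4`, every `k`). [this track, ATTEMPT-12 part 4] -/
theorem aggregateDeficit_ge_slope_sharp (k : ℕ) (hN7 : (10 : ℝ) ^ 7 ≤ N) {δ : ℝ} (hδ : 0 < δ) (hδ4 : δ ≤ 1 / 4) :
    (1 - 1 / ((k : ℝ) + 2)) ^ 2 * Real.sqrt N * δ - Real.log (2 / δ) - flatEnergyConst k - 6.1 ≤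
      aggregateDeficit N (Real.log N / 2 + δ) := by
  have h := semilocalGroundEnergy_le_slope_sharp k (fun _ hp ↦ Nat.lt_of_mem_primesBelow hp) hN7 hδ hδ4
  unfold aggregateDeficit
  linarith only [h]

/-! ## §3 The wall ceiling with constant `1 + ε` -/

/-- **THE WALL CEILING, sharp (RH-free).** For `0 < ε ≤ 1`, an order `k` with `ε(k+2) ≥ 8`, every finite `S ⊆ [0, N)`, `N ≥ 10⁷` with
`4(flatEnergyConst k + 5) ≤ ε·log N`:  `a*(S) < (log N)/2 + (1+ε)·(log N)/(2√N)`. [this track, ATTEMPT-12 part 4] -/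
theorem weilSemilocalThreshold_lt_ceiling_sharp {ε : ℝ} (hε : 0 < ε) (hε1 : ε ≤ 1) {k : ℕ} (hk : 8 ≤ ε * ((k : ℝ) + 2))
    (hS : ∀ p ∈ S, p < N) (hN7 : (10 : ℝ) ^ 7 ≤ N) (hbig : 4 * (flatEnergyConst k + 5) ≤ ε * Real.log N) :
    weilSemilocalThreshold S < Real.log N / 2 + (1 + ε) * Real.log N / (2 * Real.sqrt N) := by
  have hN0 : (0 : ℝ) < N := lt_of_lt_of_le (by norm_num) hN7
  have h16 : Real.exp 16 ≤ N := exp_sixteen_le.trans hN7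
  have hlog16 : (16 : ℝ) ≤ Real.log N := by
    rw [Real.le_log_iff_exp_le hN0]; exact h16
  have hsq : 0 < Real.sqrt N := Real.sqrt_pos.2 hN0
  have hcap : Real.log N / Real.sqrt N ≤ 0.0054 := log_div_sqrt_le_of_exp_sixteen_le h16
  set δ : ℝ := (1 + ε) * Real.log N / (2 * Real.sqrt N) with hδ_def
  have hδ : 0 < δ := by rw [hδ_def]; positivity
  have hδeq : Real.sqrt N * δ = (1 + ε) * Real.log N / 2 := by
    rw [hδ_def]; field_simp
  have hδ4 : δ ≤ 1 / 4 := by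
    have h1 : δ = (1 + ε) / 2 * (Real.log N / Real.sqrt N) := by rw [hδ_def]; ring
    rw [h1]
    nlinarith only [hcap, hε1, hε]
  -- the slope bound at this δ is negative
  have hslope := semilocalGroundEnergy_le_slope_sharp k hS hN7 hδ hδ4
  have hk2 : (0 : ℝ) < (k : ℝ) + 2 := by positivity
  have hρ : 1 - ε / 8 ≤ 1 - 1 / ((k : ℝ) + 2) := by
    have : 1 / ((k : ℝ) + 2) ≤ ε / 8 := by
      rw [div_le_div_iff₀ hk2 (by norm_num)]; linarith only [hk]
    linarith only [this]
  have hρ0 : 0 ≤ 1 - ε / 8 := by linarith only [hε1]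
  have hρ2 : (1 - ε / 8) ^ 2 ≤ (1 - 1 / ((k : ℝ) + 2)) ^ 2 := pow_le_pow_left₀ hρ0 hρ 2
  have hρ3 : 1 - ε / 4 ≤ (1 - 1 / ((k : ℝ) + 2)) ^ 2 := by nlinarith only [hρ2, hε]
  -- `log(2/δ) ≤ (log N)/2 − 1.37`
  have hlogpos : 0 < Real.log N := by linarith only [hlog16]
  have hlogδ : Real.log (2 / δ) ≤ Real.log N / 2 - 1.37 := by
    have h2δ : 2 / δ ≤ 4 * Real.sqrt N / Real.log N := by
      rw [div_le_div_iff₀ hδ hlogpos]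
      have h0 : 0 ≤ ε * Real.log N := by positivity
      linarith only [hδeq, h0]
    have hlog4 : Real.log 4 ≤ 1.3863 := Literature.NumberTheory.Sieve.log_four_le
    have hloglog : Real.log 16 ≤ Real.log (Real.log N) := Real.log_le_log (by norm_num) hlog16
    have hl16 : (2.76 : ℝ) ≤ Real.log 16 := by
      have : Real.log 16 = 4 * Real.log 2 := by
        rw [show (16 : ℝ) = 2 ^ 4 by norm_num, Real.log_pow]; norm_num
      rw [this]; linarith only [Real.log_two_gt_d9]
    calc Real.log (2 / δ) ≤ Real.log (4 * Real.sqrt N / Real.log N) := Real.log_le_log (by positivity) h2δ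
      _ = Real.log 4 + Real.log N / 2 - Real.log (Real.log N) := by
          rw [Real.log_div (by positivity) hlogpos.ne', Real.log_mul (by norm_num) hsq.ne', Real.log_sqrt hN0.le]
      _ ≤ Real.log N / 2 - 1.37 := by linarith only [hlog4, hloglog, hl16]
  -- assemble: λ_min < 0
  have hneg : semilocalGroundEnergy S (fun _ ↦ True) (Real.log N / 2 + δ) < 0 := by
    have h1 : (1 - 1 / ((k : ℝ) + 2)) ^ 2 * Real.sqrt N * δ ≥ (1 - ε / 4) * ((1 + ε) * Real.log N / 2) := by
      rw [mul_assoc, hδeq]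
      exact mul_le_mul_of_nonneg_right hρ3 (by positivity)
    have h2 : (1 - ε / 4) * ((1 + ε) * Real.log N / 2) ≥ Real.log N / 2 + ε / 4 * Real.log N := by
      have h3 : 0 ≤ (1 - ε) * ε * Real.log N := mul_nonneg (mul_nonneg (by linarith only [hε1]) hε.le) hlogpos.le
      linarith only [h3]
    linarith only [hslope, h1, h2, hlogδ, hbig]
  have hlt : ¬ (Real.log N / 2 + δ ≤ weilSemilocalThreshold S) := fun hle ↦
    absurd (semilocalGroundEnergy_top_nonneg_iff_le_threshold.2 hle) (not_le.2 hneg)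
  rw [hδ_def] at hlt
  exact not_le.1 hlt

/-- **The wall sequence under the sharp ceiling (RH-free)**: `W(N) < (log N)/2 + (1+ε)(log N)/(2√N)` under the hypotheses of
`weilSemilocalThreshold_lt_ceiling_sharp`. [this track, ATTEMPT-12 part 4] -/
theorem wall_lt_ceiling_sharp {ε : ℝ} (hε : 0 < ε) (hε1 : ε ≤ 1) {k : ℕ} (hk : 8 ≤ ε * ((k : ℝ) + 2))
    (hN7 : (10 : ℝ) ^ 7 ≤ N) (hbig : 4 * (flatEnergyConst k + 5) ≤ ε * Real.log N) :
    weilSemilocalThreshold (Nat.primesBelow N) < Real.log N / 2 + (1 + ε) * Real.log N / (2 * Real.sqrt N) :=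
  weilSemilocalThreshold_lt_ceiling_sharp hε hε1 hk (fun _ hp ↦ Nat.lt_of_mem_primesBelow hp) hN7 hbig

/-- **For every `ε > 0` the wall sequence eventually sits below `(log N)/2 + (1+ε)(log N)/(2√N)` (RH-free).** The constant `1` is the exact reach
of edge-localised odd witnesses (gen3's `edgeNonnegOdd_sharp_classification`); the threshold is symbolic (Mathlib's bump). [this track, ATTEMPT-12 part 4] -/
theorem exists_forall_wall_lt_ceiling_sharp {ε : ℝ} (hε : 0 < ε) :
    ∃ N₀ : ℕ, ∀ N ≥ N₀,
      weilSemilocalThreshold (Nat.primesBelow N) < Real.log N / 2 + (1 + ε) * Real.log N / (2 * Real.sqrt N) := by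
  set ε' : ℝ := min ε 1 with hε'_def
  have hε' : 0 < ε' := lt_min hε one_pos
  have hε'1 : ε' ≤ 1 := min_le_right _ _
  have hε'ε : ε' ≤ ε := min_le_left _ _
  set k : ℕ := ⌈8 / ε'⌉₊ with hk_def
  have hk : 8 ≤ ε' * ((k : ℝ) + 2) := by
    have h1 : 8 / ε' ≤ (k : ℝ) := Nat.le_ceil _
    rw [div_le_iff₀ hε'] at h1
    nlinarith only [h1, hε']
  set T : ℝ := 4 * (flatEnergyConst k + 5) / ε' with hT_def
  refine ⟨max (10 ^ 7) (⌈Real.exp T⌉₊), fun N hN ↦ ?_⟩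
  have hN7 : (10 : ℝ) ^ 7 ≤ N := by
    have : 10 ^ 7 ≤ N := (le_max_left _ _).trans hN
    exact_mod_cast this
  have hN0 : (0 : ℝ) < N := lt_of_lt_of_le (by norm_num) hN7
  have hbig : 4 * (flatEnergyConst k + 5) ≤ ε' * Real.log N := by
    have h1 : Real.exp T ≤ N := (Nat.le_ceil _).trans (by exact_mod_cast (le_max_right _ _).trans hN)
    have h2 : T ≤ Real.log N := by rw [Real.le_log_iff_exp_le hN0]; exact h1
    rw [hT_def, div_le_iff₀ hε'] at h2
    linarith only [h2]
  have h := wall_lt_ceiling_sharp hε' hε'1 hk hN7 hbig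
  have hmono : (1 + ε') * Real.log N / (2 * Real.sqrt N) ≤ (1 + ε) * Real.log N / (2 * Real.sqrt N) := by
    have hl : 0 ≤ Real.log N := Real.log_nonneg (by linarith only [hN7])
    exact div_le_div_of_nonneg_right (mul_le_mul_of_nonneg_right (by linarith only [hε'ε]) hl) (by positivity)
  linarith only [h, hmono]

end Summit.RiemannHypothesis.RiemannHypothesis.Theorems.Handoff
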